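import Summits.QuantumFields.YangMills.Theorems.LogConcaveChartTransportPoincare
import Summits.QuantumFields.YangMills.Theorems.LogConcaveChartTransportGaussianSide

/-!
# Route `LogConcaveChart` — toolkit for the support item `TransportCovarianceTransfer`
(stmt-QuantumFields-23668, child of the transport split of crux `QuadraticCovarianceComparison`,
stmt-QuantumFields-26240): **growth and integrability bookkeeping; Poincaré with a dominated gradient**

Isotropic frame `γ = 𝒩(0, I_n) = Measure.pi (fun _ => gaussianReal 0 1)`.  This file supplies the
`L¹ ∩ L²(γ)` side conditions the transfer needs, all from elementary dot-product inequalities: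

* `variance_le_of_dominated_gradient` — the tree's Gaussian Poincaré inequality in the form used for
  the transport remainder: `φ ∈ C¹ ∩ L¹ ∩ L²(γ)`, `∑ᵢ(∂ᵢφ)² ≤ g` pointwise with `g ∈ L¹(γ)` ⇒
  `Var_γ φ ≤ (π²/8) ∫ g dγ` (no boundedness of `φ` required);
* `integrable_of_quadratic_growth` — a continuous `φ` with `|φ x| ≤ a + c|x|²` is in `L¹ ∩ L²(γ)`
  (fourth moments, `integrable_eval_four_pi`);
* `mulVec_dotProduct_self_le` (`|Hz|² ≤ ‖H‖_F²|z|²`), `two_mul_abs_quadForm_le`,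
  `two_mul_abs_dotProduct_le`, `dotProduct_self_add_le` — dot-product inequalities;
* `displacement_sq_le` — `|T x − x|² ≤ 2|T 0|² + 2δ²|x|²` from the Lipschitz bound on `T − id`;
* `exists_quadObs_comp_growth`, `integrable_quadObs_comp` — the quadratic observable
  `q_{H,b} ∘ T` has quadratic growth, hence `q_{H,b} ∘ T ∈ L¹ ∩ L²(γ)` (and `T = id` is allowed).

HONEST SCOPE. Helper lemmas toward ONE support item of a sub-line; nothing here proves
`TransportCovarianceTransfer`, `QuadraticCovarianceComparison`, the `LogConcaveChart` thesis, rung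
R2a (`BalabanLadder.NT`) or any summit statement; the Yang–Mills mass gap is NOT proved.
Filed by ideator seat ym-idea-8 (generation 8, lens «dual» = transport side).
-/

namespace Summit.QuantumFields.YangMills.Cruxes.TransportCovarianceTransfer

open MeasureTheory ProbabilityTheory
open scoped NNReal ENNReal

variable {n : ℕ}

/-! ### Poincaré with a dominated gradient -/

/-- **Gaussian Poincaré, dominated-gradient form.** For `γ = 𝒩(0, I_n)`, `φ ∈ C¹` with
`φ, φ² ∈ L¹(γ)` and `∑ᵢ (∂ᵢφ)² ≤ g` pointwise for some `g ≥ 0` in `L¹(γ)`: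
`∫ φ² dγ − (∫ φ dγ)² ≤ (π²/8) ∫ g dγ`. [folklore] -/
theorem variance_le_of_dominated_gradient {φ : (Fin n → ℝ) → ℝ} (hφ : ContDiff ℝ 1 φ)
    (h1 : Integrable φ (Measure.pi fun _ : Fin n => gaussianReal 0 1))
    (h2 : Integrable (fun x => φ x ^ 2) (Measure.pi fun _ : Fin n => gaussianReal 0 1))
    {g : (Fin n → ℝ) → ℝ} (hg0 : ∀ x, 0 ≤ g x)
    (hg : Integrable g (Measure.pi fun _ : Fin n => gaussianReal 0 1))
    (hdom : ∀ x, ∑ i, (fderiv ℝ φ x (Pi.single i 1)) ^ 2 ≤ g x) :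
    ∫ x, φ x ^ 2 ∂(Measure.pi fun _ : Fin n => gaussianReal 0 1) -
        (∫ x, φ x ∂(Measure.pi fun _ : Fin n => gaussianReal 0 1)) ^ 2 ≤
      Real.pi ^ 2 / 8 * ∫ x, g x ∂(Measure.pi fun _ : Fin n => gaussianReal 0 1) := by
  set γ : Measure (Fin n → ℝ) := Measure.pi fun _ : Fin n => gaussianReal 0 1 with hγ
  have key := Literature.Probability.Distributions.lintegral_sq_sub_le_pi_gaussianReal (1 : ℝ≥0) hφ
  rw [← hγ] at key
  set m : ℝ := ∫ x, φ x ∂γ with hm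
  set s : ℝ := ∫ x, φ x ^ 2 ∂γ with hs
  have hin : ∀ x, ∫⁻ y, ENNReal.ofReal ((φ x - φ y) ^ 2) ∂γ =
      ENNReal.ofReal (∫ y, (φ x - φ y) ^ 2 ∂γ) :=
    fun x => (ofReal_integral_eq_lintegral_ofReal
      (Literature.Probability.Distributions.integrable_sq_sub γ h1 h2 (φ x))
      (ae_of_all _ fun y => sq_nonneg _)).symm
  have hout_int : Integrable (fun x => ∫ y, (φ x - φ y) ^ 2 ∂γ) γ := by
    have e1 : (fun x => ∫ y, (φ x - φ y) ^ 2 ∂γ) = fun x => φ x ^ 2 - 2 * φ x * m + s := by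
      funext x
      rw [Literature.Probability.Distributions.integral_sq_sub_eq γ h1 h2]
    rw [e1]
    exact (h2.sub ((h1.const_mul 2).mul_const m)).add (integrable_const _)
  have hL : ∫⁻ x, ∫⁻ y, ENNReal.ofReal ((φ x - φ y) ^ 2) ∂γ ∂γ =
      ENNReal.ofReal (2 * s - 2 * m ^ 2) := by
    simp_rw [hin]
    rw [← ofReal_integral_eq_lintegral_ofReal hout_int
      (ae_of_all _ fun x => integral_nonneg fun y => sq_nonneg _),
      Literature.Probability.Distributions.integral_integral_sq_sub γ h1 h2]
  have hR : ∫⁻ x, ENNReal.ofReal (∑ i, (fderiv ℝ φ x (Pi.single i 1)) ^ 2) ∂γ ≤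
      ENNReal.ofReal (∫ x, g x ∂γ) := by
    calc ∫⁻ x, ENNReal.ofReal (∑ i, (fderiv ℝ φ x (Pi.single i 1)) ^ 2) ∂γ
        ≤ ∫⁻ x, ENNReal.ofReal (g x) ∂γ := lintegral_mono fun x => ENNReal.ofReal_le_ofReal (hdom x)
      _ = ENNReal.ofReal (∫ x, g x ∂γ) :=
          (ofReal_integral_eq_lintegral_ofReal hg (ae_of_all _ hg0)).symm
  have hG0 : 0 ≤ ∫ x, g x ∂γ := integral_nonneg hg0
  have key' : ENNReal.ofReal (2 * s - 2 * m ^ 2) ≤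
      ENNReal.ofReal (Real.pi ^ 2 / 4 * ∫ x, g x ∂γ) := by
    calc ENNReal.ofReal (2 * s - 2 * m ^ 2)
        = ∫⁻ x, ∫⁻ y, ENNReal.ofReal ((φ x - φ y) ^ 2) ∂γ ∂γ := hL.symm
      _ ≤ ENNReal.ofReal (Real.pi ^ 2 / 4 * ((1 : ℝ≥0) : ℝ)) *
            ∫⁻ x, ENNReal.ofReal (∑ i, (fderiv ℝ φ x (Pi.single i 1)) ^ 2) ∂γ := key
      _ ≤ ENNReal.ofReal (Real.pi ^ 2 / 4 * ((1 : ℝ≥0) : ℝ)) * ENNReal.ofReal (∫ x, g x ∂γ) := by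
            gcongr
      _ = ENNReal.ofReal (Real.pi ^ 2 / 4 * ∫ x, g x ∂γ) := by
            rw [NNReal.coe_one, mul_one, ← ENNReal.ofReal_mul (by positivity)]
  have hpos : 0 ≤ Real.pi ^ 2 / 4 * ∫ x, g x ∂γ := by positivity
  have := (ENNReal.ofReal_le_ofReal_iff hpos).1 key'
  rw [hs, hm] at this
  linarith

/-! ### Dot-product inequalities -/

/-- `|Hz|² ≤ ‖H‖_F² |z|²` (Cauchy–Schwarz row by row). [folklore] -/
theorem mulVec_dotProduct_self_le (H : Matrix (Fin n) (Fin n) ℝ) (z : Fin n → ℝ) :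
    H.mulVec z ⬝ᵥ H.mulVec z ≤ (∑ i, ∑ j, H i j ^ 2) * (z ⬝ᵥ z) := by
  have hsq : H.mulVec z ⬝ᵥ H.mulVec z = ∑ i, (H i ⬝ᵥ z) ^ 2 := by
    simp only [dotProduct, Matrix.mulVec, sq]
  rw [hsq, Finset.sum_mul]
  refine Finset.sum_le_sum fun i _ => ?_
  have h := Literature.MathematicalPhysics.QuantumFieldTheory.Balaban1983to89.T4GnomonicWilsonHessian.dotProduct_sq_le
    (H i) z
  have e : H i ⬝ᵥ H i = ∑ j, H i j ^ 2 := by simp only [dotProduct, sq]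
  rw [e] at h
  exact h

/-- `2|u·v| ≤ u·u + v·v`. [folklore] -/
theorem two_mul_abs_dotProduct_le (u v : Fin n → ℝ) : 2 * |u ⬝ᵥ v| ≤ u ⬝ᵥ u + v ⬝ᵥ v := by
  have h1 : 0 ≤ (u - v) ⬝ᵥ (u - v) := Finset.sum_nonneg fun _ _ => mul_self_nonneg _
  have h2 : 0 ≤ (u + v) ⬝ᵥ (u + v) := Finset.sum_nonneg fun _ _ => mul_self_nonneg _
  have e1 : (u - v) ⬝ᵥ (u - v) = u ⬝ᵥ u - 2 * (u ⬝ᵥ v) + v ⬝ᵥ v := by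
    simp only [sub_dotProduct, dotProduct_sub, dotProduct_comm v u]; ring
  have e2 : (u + v) ⬝ᵥ (u + v) = u ⬝ᵥ u + 2 * (u ⬝ᵥ v) + v ⬝ᵥ v := by
    simp only [add_dotProduct, dotProduct_add, dotProduct_comm v u]; ring
  rw [e1] at h1
  rw [e2] at h2
  rcases le_or_gt 0 (u ⬝ᵥ v) with h | h
  · rw [abs_of_nonneg h]; linarith
  · rw [abs_of_neg h]; linarith

/-- `2|zᵀHz| ≤ (1 + ‖H‖_F²)|z|²`. [folklore] -/
theorem two_mul_abs_quadForm_le (H : Matrix (Fin n) (Fin n) ℝ) (z : Fin n → ℝ) :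
    2 * |z ⬝ᵥ H.mulVec z| ≤ (1 + ∑ i, ∑ j, H i j ^ 2) * (z ⬝ᵥ z) := by
  have h1 := two_mul_abs_dotProduct_le z (H.mulVec z)
  have h2 := mulVec_dotProduct_self_le H z
  have h0 : 0 ≤ z ⬝ᵥ z := Finset.sum_nonneg fun _ _ => mul_self_nonneg _
  nlinarith [h1, h2, h0]

/-- `(u + v)·(u + v) ≤ 2 u·u + 2 v·v`. [folklore] -/
theorem dotProduct_self_add_le (u v : Fin n → ℝ) :
    (u + v) ⬝ᵥ (u + v) ≤ 2 * (u ⬝ᵥ u) + 2 * (v ⬝ᵥ v) := by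
  have h1 : 0 ≤ (u - v) ⬝ᵥ (u - v) := Finset.sum_nonneg fun _ _ => mul_self_nonneg _
  have e1 : (u - v) ⬝ᵥ (u - v) = u ⬝ᵥ u - 2 * (u ⬝ᵥ v) + v ⬝ᵥ v := by
    simp only [sub_dotProduct, dotProduct_sub, dotProduct_comm v u]; ring
  have e2 : (u + v) ⬝ᵥ (u + v) = u ⬝ᵥ u + 2 * (u ⬝ᵥ v) + v ⬝ᵥ v := by
    simp only [add_dotProduct, dotProduct_add, dotProduct_comm v u]; ring
  rw [e1] at h1
  rw [e2]
  linarith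

/-- **Displacement growth.** If `T − id` is `δ`-Lipschitz (`|T x − T y − (x − y)|² ≤ δ²|x − y|²`) then
`|T x − x|² ≤ 2|T 0|² + 2δ²|x|²`. [folklore] -/
theorem displacement_sq_le {δ : ℝ} {T : (Fin n → ℝ) → (Fin n → ℝ)}
    (hLip : ∀ x y, (T x - T y - (x - y)) ⬝ᵥ (T x - T y - (x - y)) ≤ δ ^ 2 * ((x - y) ⬝ᵥ (x - y)))
    (x : Fin n → ℝ) :
    (T x - x) ⬝ᵥ (T x - x) ≤ 2 * (T 0 ⬝ᵥ T 0) + 2 * (δ ^ 2 * (x ⬝ᵥ x)) := by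
  have h := hLip x 0
  simp only [sub_zero] at h
  have e : T x - x = T 0 + (T x - T 0 - x) := by abel
  rw [e]
  calc (T 0 + (T x - T 0 - x)) ⬝ᵥ (T 0 + (T x - T 0 - x))
      ≤ 2 * (T 0 ⬝ᵥ T 0) + 2 * ((T x - T 0 - x) ⬝ᵥ (T x - T 0 - x)) := dotProduct_self_add_le _ _
    _ ≤ 2 * (T 0 ⬝ᵥ T 0) + 2 * (δ ^ 2 * (x ⬝ᵥ x)) := by linarith

/-- `|T x|² ≤ (2 + 4δ²)|x|² + 4|T 0|²`. [folklore] -/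
theorem map_sq_le {δ : ℝ} {T : (Fin n → ℝ) → (Fin n → ℝ)}
    (hLip : ∀ x y, (T x - T y - (x - y)) ⬝ᵥ (T x - T y - (x - y)) ≤ δ ^ 2 * ((x - y) ⬝ᵥ (x - y)))
    (x : Fin n → ℝ) :
    T x ⬝ᵥ T x ≤ (2 + 4 * δ ^ 2) * (x ⬝ᵥ x) + 4 * (T 0 ⬝ᵥ T 0) := by
  have h := displacement_sq_le hLip x
  have e : T x = x + (T x - x) := by abel
  rw [e]
  have h2 := dotProduct_self_add_le x (T x - x)
  have h0 : 0 ≤ x ⬝ᵥ x := Finset.sum_nonneg fun _ _ => mul_self_nonneg _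
  nlinarith [h, h2, h0]

/-! ### Integrability under `γ` -/

/-- `|x|⁴ = (x·x)² ∈ L¹(γ)` (fourth moments). [folklore] -/
theorem integrable_dotProduct_self_sq :
    Integrable (fun x : Fin n → ℝ => (x ⬝ᵥ x) ^ 2) (Measure.pi fun _ : Fin n => gaussianReal 0 1) := by
  have e : (fun x : Fin n → ℝ => (x ⬝ᵥ x) ^ 2) = fun x => ∑ i, ∑ j, x i * x i * x j * x j := by
    funext x
    simp only [dotProduct, sq, Finset.sum_mul_sum]
    exact Finset.sum_congr rfl fun i _ => Finset.sum_congr rfl fun j _ => by ring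
  rw [e]
  exact integrable_finsetSum _ fun i _ => integrable_finsetSum _ fun j _ =>
    integrable_eval_four_pi i i j j

/-- **Quadratic growth ⇒ `L¹ ∩ L²(γ)`.** A continuous `φ` with `|φ x| ≤ a + c|x|²` has
`φ, φ² ∈ L¹(γ)`. [folklore] -/
theorem integrable_of_quadratic_growth {φ : (Fin n → ℝ) → ℝ} (hφ : Continuous φ) {a c : ℝ}
    (hle : ∀ x, |φ x| ≤ a + c * (x ⬝ᵥ x)) :
    Integrable φ (Measure.pi fun _ : Fin n => gaussianReal 0 1) ∧
      Integrable (fun x => φ x ^ 2) (Measure.pi fun _ : Fin n => gaussianReal 0 1) := by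
  set γ : Measure (Fin n → ℝ) := Measure.pi fun _ : Fin n => gaussianReal 0 1 with hγ
  have hdom : ∀ x, φ x ^ 2 ≤ 2 * a ^ 2 + 2 * c ^ 2 * (x ⬝ᵥ x) ^ 2 := by
    intro x
    have h := hle x
    have h0 : 0 ≤ a + c * (x ⬝ᵥ x) := le_trans (abs_nonneg _) h
    have h3 : φ x ^ 2 ≤ (a + c * (x ⬝ᵥ x)) ^ 2 := by
      rw [← sq_abs (φ x)]
      exact pow_le_pow_left₀ (abs_nonneg _) h 2
    nlinarith [h3, sq_nonneg (a - c * (x ⬝ᵥ x))]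
  have h2 : Integrable (fun x => φ x ^ 2) γ := by
    have hmaj : Integrable (fun x : Fin n → ℝ => 2 * a ^ 2 + 2 * c ^ 2 * (x ⬝ᵥ x) ^ 2) γ :=
      (integrable_const _).add (integrable_dotProduct_self_sq.const_mul _)
    refine hmaj.mono' (hφ.pow 2).aestronglyMeasurable (ae_of_all _ fun x => ?_)
    rw [Real.norm_eq_abs, abs_of_nonneg (sq_nonneg _)]
    exact hdom x
  have h1 : Integrable φ γ :=
    ((memLp_two_iff_integrable_sq hφ.aestronglyMeasurable).2 h2).integrable one_le_two
  exact ⟨h1, h2⟩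

/-- `L²(γ)` is closed under differences (squares of differences are integrable). [folklore] -/
theorem integrable_sq_sub_of_sq {φ ψ : (Fin n → ℝ) → ℝ} (hφ : Continuous φ) (hψ : Continuous ψ)
    (h2φ : Integrable (fun x => φ x ^ 2) (Measure.pi fun _ : Fin n => gaussianReal 0 1))
    (h2ψ : Integrable (fun x => ψ x ^ 2) (Measure.pi fun _ : Fin n => gaussianReal 0 1)) :
    Integrable (fun x => (φ x - ψ x) ^ 2) (Measure.pi fun _ : Fin n => gaussianReal 0 1) := by
  have hmaj : Integrable (fun x => 2 * φ x ^ 2 + 2 * ψ x ^ 2)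
      (Measure.pi fun _ : Fin n => gaussianReal 0 1) := (h2φ.const_mul 2).add (h2ψ.const_mul 2)
  refine hmaj.mono' ((hφ.sub hψ).pow 2).aestronglyMeasurable (ae_of_all _ fun x => ?_)
  rw [Real.norm_eq_abs, abs_of_nonneg (sq_nonneg _)]
  nlinarith [sq_nonneg (φ x + ψ x)]

/-! ### The quadratic observable along the transport map -/

/-- **Quadratic growth of `q_{H,b} ∘ T`.** If `T − id` is `δ`-Lipschitz then
`|(Tx)ᵀH(Tx) + b·Tx| ≤ a + c|x|²` for explicit `a, c`. [folklore] -/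
theorem exists_quadObs_comp_growth {δ : ℝ} {T : (Fin n → ℝ) → (Fin n → ℝ)}
    (hLip : ∀ x y, (T x - T y - (x - y)) ⬝ᵥ (T x - T y - (x - y)) ≤ δ ^ 2 * ((x - y) ⬝ᵥ (x - y)))
    (H : Matrix (Fin n) (Fin n) ℝ) (b : Fin n → ℝ) :
    ∃ a c : ℝ, ∀ x, |T x ⬝ᵥ H.mulVec (T x) + b ⬝ᵥ T x| ≤ a + c * (x ⬝ᵥ x) := by
  set K : ℝ := (2 + ∑ i, ∑ j, H i j ^ 2) / 2 with hK
  refine ⟨b ⬝ᵥ b / 2 + K * (4 * (T 0 ⬝ᵥ T 0)), K * (2 + 4 * δ ^ 2), fun x => ?_⟩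
  have h1 := two_mul_abs_quadForm_le H (T x)
  have h2 := two_mul_abs_dotProduct_le b (T x)
  have h3 := map_sq_le hLip x
  have hK0 : 0 ≤ K := by
    have : 0 ≤ ∑ i, ∑ j, H i j ^ 2 :=
      Finset.sum_nonneg fun i _ => Finset.sum_nonneg fun j _ => sq_nonneg _
    rw [hK]; positivity
  have h4 : |T x ⬝ᵥ H.mulVec (T x) + b ⬝ᵥ T x| ≤ |T x ⬝ᵥ H.mulVec (T x)| + |b ⬝ᵥ T x| :=
    abs_add_le _ _
  have h5 : |T x ⬝ᵥ H.mulVec (T x)| + |b ⬝ᵥ T x| ≤ K * (T x ⬝ᵥ T x) + b ⬝ᵥ b / 2 := by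
    rw [hK]; nlinarith [h1, h2]
  have h6 : K * (T x ⬝ᵥ T x) ≤ K * ((2 + 4 * δ ^ 2) * (x ⬝ᵥ x) + 4 * (T 0 ⬝ᵥ T 0)) :=
    mul_le_mul_of_nonneg_left h3 hK0
  nlinarith [h4, h5, h6]

/-- `q_{H,b} ∘ T` is continuous for continuous `T`. [folklore] -/
theorem continuous_quadObs_comp {T : (Fin n → ℝ) → (Fin n → ℝ)} (hT : Continuous T)
    (H : Matrix (Fin n) (Fin n) ℝ) (b : Fin n → ℝ) :
    Continuous fun x => T x ⬝ᵥ H.mulVec (T x) + b ⬝ᵥ T x := by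
  have e : (fun x => T x ⬝ᵥ H.mulVec (T x) + b ⬝ᵥ T x) =
      fun x => (∑ i, ∑ j, H i j * (T x i * T x j)) + ∑ i, b i * T x i := by
    funext x
    rw [quadForm_eq_sum, dotProduct_eq_sum]
  rw [e]
  have hc : ∀ i, Continuous fun x => T x i := fun i => (continuous_apply i).comp hT
  exact (continuous_finsetSum _ fun i _ => continuous_finsetSum _ fun j _ =>
    continuous_const.mul ((hc i).mul (hc j))).add
      (continuous_finsetSum _ fun i _ => continuous_const.mul (hc i))

/-- **`q_{H,b} ∘ T ∈ L¹ ∩ L²(γ)`** for continuous `T` with `T − id` `δ`-Lipschitz (in particular for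
`T = id`). [folklore] -/
theorem integrable_quadObs_comp {δ : ℝ} {T : (Fin n → ℝ) → (Fin n → ℝ)} (hT : Continuous T)
    (hLip : ∀ x y, (T x - T y - (x - y)) ⬝ᵥ (T x - T y - (x - y)) ≤ δ ^ 2 * ((x - y) ⬝ᵥ (x - y)))
    (H : Matrix (Fin n) (Fin n) ℝ) (b : Fin n → ℝ) :
    Integrable (fun x => T x ⬝ᵥ H.mulVec (T x) + b ⬝ᵥ T x)
        (Measure.pi fun _ : Fin n => gaussianReal 0 1) ∧
      Integrable (fun x => (T x ⬝ᵥ H.mulVec (T x) + b ⬝ᵥ T x) ^ 2)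
        (Measure.pi fun _ : Fin n => gaussianReal 0 1) := by
  obtain ⟨a, c, hac⟩ := exists_quadObs_comp_growth hLip H b
  exact integrable_of_quadratic_growth (continuous_quadObs_comp hT H b) hac

/-- The identity map satisfies the Lipschitz hypothesis (with any `δ`). [folklore] -/
theorem lipschitz_hyp_id (δ : ℝ) (x y : Fin n → ℝ) :
    ((fun z : Fin n → ℝ => z) x - (fun z : Fin n → ℝ => z) y - (x - y)) ⬝ᵥ
        ((fun z : Fin n → ℝ => z) x - (fun z : Fin n → ℝ => z) y - (x - y)) ≤
      δ ^ 2 * ((x - y) ⬝ᵥ (x - y)) := by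
  simp only [sub_self, dotProduct_zero]
  exact mul_nonneg (sq_nonneg _) (Finset.sum_nonneg fun _ _ => mul_self_nonneg _)

/-- **`q_{H,b} ∈ L¹ ∩ L²(γ)`.** [folklore] -/
theorem integrable_quadObs (H : Matrix (Fin n) (Fin n) ℝ) (b : Fin n → ℝ) :
    Integrable (fun x => x ⬝ᵥ H.mulVec x + b ⬝ᵥ x) (Measure.pi fun _ : Fin n => gaussianReal 0 1) ∧
      Integrable (fun x => (x ⬝ᵥ H.mulVec x + b ⬝ᵥ x) ^ 2)
        (Measure.pi fun _ : Fin n => gaussianReal 0 1) :=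
  integrable_quadObs_comp (T := fun z => z) continuous_id (lipschitz_hyp_id (n := n) 0) H b

end Summit.QuantumFields.YangMills.Cruxes.TransportCovarianceTransfer
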